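import Mathlib
import Literature.Combinatorics.Additive.TripleProductProperty
import Summits.MatrixMultiplication.MatrixMultiplication.Theorems.SnSubsetDichotomyHyperoctahedralSubsetsGroupPacking

/-!
# `SnSubsetDichotomy.HyperoctahedralSubsets`, line `spherical-rank-sieve` — the RELATIVE packing lemma

Crux `stmt-MatrixMultiplication-8305` (`HyperoctahedralSubsets`), co-lead c2 brick (`--supports`).

The landed group-packing lemma (`stub_groupPacking`, file `…GroupPacking.lean`) bounds the volume of a
TPP triple `X_i ⊆ C(μ_i)` by `|C(μ₀)||C(μ₁)||C(μ₂)| / |T|` for every *product-one* subgroup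
`T ≤ C(μ₀) × C(μ₁) × C(μ₂)` (every `(a, b, c) ∈ T` has `abc = 1`).  Reading its proof shows that the
product-one identity is invoked at exactly one place: for the single collision element `δ ∈ T`, and
only after its three components have been identified as right quotients `x_i' x_i⁻¹ ∈ Q(X_i) = X_i X_i⁻¹`.
Hence the hypothesis can be weakened from "every element of `T` has product one" to

  (REL)  every `t ∈ T` whose components lie in `Q(X₀)`, `Q(X₁)`, `Q(X₂)` respectively has product one,

with the same conclusion `|X₀||X₁||X₂| · |T| ≤ |C(μ₀)||C(μ₁)||C(μ₂)|`.  This is the **relative (set-adapted)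
packing lemma** (`card_mul_card_le_of_tpp_of_relHosted`, abstract group; `stub_relativePacking`, the three
centralisers in `S_n`).  It contains as its two extreme instances

* the host-only instance: `T` product-one (no condition on the `X_i`) — then (REL) holds trivially and
  `stub_relativePacking` specialises to the landed `stub_groupPacking` verbatim (not re-derived here to keep
  the tree free of duplicate statements);
* the set-only / pairwise instance: `T = {(a, a, 1) : a ∈ A}` for any finite `A ⊆ C(μ₀) ∩ C(μ₁)` closed
  under `a⁻¹ b` — here (REL) holds because `a ∈ Q(X₀) ∩ Q(X₁)` forces `a = 1` by the TPP itself
  (`diagonalPacking`: `vol · |A| ≤ |C(μ₀)||C(μ₁)||C(μ₂)|`, a cubic form of Cohn–Umans pairwise packing);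

and everything in between (subgroups `T` that are product-one only "where the quotient sets can see
them").  It is the one lever on the table that uses the structure of the SETS `X_i` and of the HOSTS
simultaneously; recorded here so that a planner can aim a structure-vs-randomness split of the `X_i`
at it (memo `Cruxes/HyperoctahedralSubsets/LeadC2-ScaleWall.md`, §4).

No involution, fixed-point-freeness or finiteness-of-`P` hypothesis is used.
References: Cohn–Umans 2003, Lemma 3.1 (`T = 1`); the product-one version is this line's
`stub_groupPacking` (p74548).
-/

-- the project's summit namespace `Summit.MatrixMultiplication.MatrixMultiplication` repeats a component by design (D-0022)
set_option linter.dupNamespace false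

namespace Summit.MatrixMultiplication.MatrixMultiplication.Theorems.HyperoctahedralSubsets

open Literature.Combinatorics.Additive

/-- **Relative packing in an abstract group.**  Let `P` be a group, `C₀, C₁, C₂ ⊆ P` finite host sets
closed under `(a, b) ↦ a⁻¹ b`, `X_i ⊆ C_i` a triple with the triple product property, and `T ⊆ P³` a
non-empty finite set closed under componentwise product and inverse whose elements are hosted
(`t.1 ∈ C₀`, `t.2.1 ∈ C₁`, `t.2.2 ∈ C₂`) and satisfy the RELATIVE product-one condition: whenever
`t.1 = x' x⁻¹`, `t.2.1 = y' y⁻¹`, `t.2.2 = z' z⁻¹` with `x, x' ∈ X₀`, `y, y' ∈ X₁`, `z, z' ∈ X₂`, then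
`t.1 · t.2.1 · t.2.2 = 1`.  Then `|X₀||X₁||X₂| · |T| ≤ |C₀||C₁||C₂|`.  Proof: the packing map
`(d₀, d₁, d₂, x₀, x₁, x₂) ↦ ((a_{d₀}⁻¹ x₀, b_{d₁}⁻¹ x₁, c_{d₂}⁻¹ x₂), (d₀⁻¹ d₁, d₁⁻¹ d₂))` from
`T³ × X₀ × X₁ × X₂` to `(C₀ × C₁ × C₂) × T²` is injective — a collision produces one `δ ∈ T` with
`δ.1 = x₀' x₀⁻¹`, `δ.2.1 = x₁' x₁⁻¹`, `δ.2.2 = x₂' x₂⁻¹`, so (REL) applies to `δ` and the triple product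
property gives `x_i' = x_i`, `δ = 1`. [folklore] -/
theorem card_mul_card_le_of_tpp_of_relHosted {P : Type*} [Group P]
    {C₀ C₁ C₂ X₀ X₁ X₂ : Finset P} {T : Finset (P × P × P)}
    (hX₀ : X₀ ⊆ C₀) (hX₁ : X₁ ⊆ C₁) (hX₂ : X₂ ⊆ C₂)
    (hC₀ : ∀ a ∈ C₀, ∀ b ∈ C₀, a⁻¹ * b ∈ C₀) (hC₁ : ∀ a ∈ C₁, ∀ b ∈ C₁, a⁻¹ * b ∈ C₁)
    (hC₂ : ∀ a ∈ C₂, ∀ b ∈ C₂, a⁻¹ * b ∈ C₂)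
    (hTPP : TripleProductProperty X₀ X₁ X₂)
    (hmul : ∀ s ∈ T, ∀ t ∈ T, s * t ∈ T) (hinv : ∀ t ∈ T, t⁻¹ ∈ T) (hT : T.Nonempty)
    (hhost : ∀ t ∈ T, t.1 ∈ C₀ ∧ t.2.1 ∈ C₁ ∧ t.2.2 ∈ C₂)
    (hrel : ∀ t ∈ T, (∃ x ∈ X₀, ∃ x' ∈ X₀, x' * x⁻¹ = t.1) →
      (∃ y ∈ X₁, ∃ y' ∈ X₁, y' * y⁻¹ = t.2.1) → (∃ z ∈ X₂, ∃ z' ∈ X₂, z' * z⁻¹ = t.2.2) →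
        t.1 * t.2.1 * t.2.2 = 1) :
    X₀.card * X₁.card * X₂.card * T.card ≤ C₀.card * C₁.card * C₂.card := by
  -- the packing map, on `T³ × (X₀ × X₁ × X₂)` with values in `(C₀ × C₁ × C₂) × (T × T)`
  obtain ⟨Φ, hΦ⟩ : ∃ Φ : (P × P × P) × (P × P × P) × (P × P × P) × P × P × P →
      (P × P × P) × (P × P × P) × (P × P × P),
      ∀ d, Φ d = ((d.1.1⁻¹ * d.2.2.2.1, d.2.1.2.1⁻¹ * d.2.2.2.2.1, d.2.2.1.2.2⁻¹ * d.2.2.2.2.2),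
        d.1⁻¹ * d.2.1, d.2.1⁻¹ * d.2.2.1) :=
    ⟨_, fun _ => rfl⟩
  have hmaps : Set.MapsTo Φ ↑(T ×ˢ T ×ˢ T ×ˢ (X₀ ×ˢ X₁ ×ˢ X₂)) ↑((C₀ ×ˢ C₁ ×ˢ C₂) ×ˢ T ×ˢ T) := by
    rintro ⟨d₀, d₁, d₂, x₀, x₁, x₂⟩ hd
    simp only [Finset.coe_product, Set.mem_prod, Finset.mem_coe] at hd
    obtain ⟨hd₀, hd₁, hd₂, hx₀, hx₁, hx₂⟩ := hd
    simp only [hΦ, Finset.coe_product, Set.mem_prod, Finset.mem_coe]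
    exact ⟨⟨hC₀ _ (hhost _ hd₀).1 _ (hX₀ hx₀), hC₁ _ (hhost _ hd₁).2.1 _ (hX₁ hx₁),
      hC₂ _ (hhost _ hd₂).2.2 _ (hX₂ hx₂)⟩, hmul _ (hinv _ hd₀) _ hd₁, hmul _ (hinv _ hd₁) _ hd₂⟩
  have hinj : Set.InjOn Φ ↑(T ×ˢ T ×ˢ T ×ˢ (X₀ ×ˢ X₁ ×ˢ X₂)) := by
    rintro ⟨d₀, d₁, d₂, x₀, x₁, x₂⟩ hd ⟨d₀', d₁', d₂', x₀', x₁', x₂'⟩ hd' he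
    simp only [Finset.coe_product, Set.mem_prod, Finset.mem_coe] at hd hd'
    obtain ⟨hd₀, -, -, hx₀, hx₁, hx₂⟩ := hd
    obtain ⟨hd₀', -, -, hx₀', hx₁', hx₂'⟩ := hd'
    simp only [hΦ, Prod.mk.injEq] at he
    obtain ⟨⟨e₀, e₁, e₂⟩, e₃, e₄⟩ := he
    -- all three `d_i'` differ from `d_i` by the same left factor `δ := d₀' d₀⁻¹ ∈ T`
    have h₁ : d₁' = d₀' * d₀⁻¹ * d₁ := by rw [mul_assoc, e₃, mul_inv_cancel_left]
    have h₂ : d₂' = d₀' * d₀⁻¹ * d₂ := by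
      calc d₂' = d₁' * (d₁'⁻¹ * d₂') := (mul_inv_cancel_left _ _).symm
        _ = d₀' * d₀⁻¹ * d₁ * (d₁⁻¹ * d₂) := by rw [← e₄, ← h₁]
        _ = d₀' * d₀⁻¹ * d₂ := by rw [mul_assoc, mul_inv_cancel_left]
    obtain ⟨δ, hδ, hδ₀, hδ₁, hδ₂⟩ :
        ∃ δ ∈ T, d₀' = δ * d₀ ∧ d₁' = δ * d₁ ∧ d₂' = δ * d₂ :=
      ⟨d₀' * d₀⁻¹, hmul _ hd₀' _ (hinv _ hd₀), (inv_mul_cancel_right _ _).symm, h₁, h₂⟩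
    clear h₁ h₂ e₃ e₄
    subst hδ₀ hδ₁ hδ₂
    -- the first block: `x_i' x_i⁻¹` are the components of `δ`
    simp only [Prod.fst_mul, Prod.snd_mul, mul_inv_rev, mul_assoc, mul_right_inj] at e₀ e₁ e₂
    have q₀ : x₀' * x₀⁻¹ = δ.1 := by rw [e₀, mul_inv_rev, inv_inv, mul_inv_cancel_left]
    have q₁ : x₁' * x₁⁻¹ = δ.2.1 := by rw [e₁, mul_inv_rev, inv_inv, mul_inv_cancel_left]
    have q₂ : x₂' * x₂⁻¹ = δ.2.2 := by rw [e₂, mul_inv_rev, inv_inv, mul_inv_cancel_left]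
    -- (REL) applies to `δ`: its components are right quotients of the `X_i`
    have hprod : δ.1 * δ.2.1 * δ.2.2 = 1 :=
      hrel δ hδ ⟨x₀, hx₀, x₀', hx₀', q₀⟩ ⟨x₁, hx₁, x₁', hx₁', q₁⟩ ⟨x₂, hx₂, x₂', hx₂', q₂⟩
    have key : x₀' * x₀⁻¹ * (x₁' * x₁⁻¹) * (x₂' * x₂⁻¹) = 1 := by
      rw [q₀, q₁, q₂]; exact hprod
    obtain ⟨rfl, rfl, rfl⟩ := hTPP x₀' hx₀' x₀ hx₀ x₁' hx₁' x₁ hx₁ x₂' hx₂' x₂ hx₂ key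
    rw [mul_inv_cancel] at q₀ q₁ q₂
    have hδ1 : δ = 1 := Prod.ext q₀.symm (Prod.ext q₁.symm q₂.symm)
    subst hδ1
    simp only [one_mul]
  have hle := Finset.card_le_card_of_injOn Φ hmaps hinj
  have hTpos : 0 < T.card := Finset.card_pos.2 hT
  have key : X₀.card * X₁.card * X₂.card * T.card * (T.card * T.card) ≤
      C₀.card * C₁.card * C₂.card * (T.card * T.card) := by
    calc X₀.card * X₁.card * X₂.card * T.card * (T.card * T.card)
        = (T ×ˢ T ×ˢ T ×ˢ (X₀ ×ˢ X₁ ×ˢ X₂)).card := by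
          simp only [Finset.card_product]; ring
      _ ≤ ((C₀ ×ˢ C₁ ×ˢ C₂) ×ˢ T ×ˢ T).card := hle
      _ = C₀.card * C₁.card * C₂.card * (T.card * T.card) := by
          simp only [Finset.card_product]; ring
  exact le_of_mul_le_mul_right key (Nat.mul_pos hTpos hTpos)

/-- **Relative packing inside the three hosts** (crux `SnSubsetDichotomy.HyperoctahedralSubsets`,
stmt-MatrixMultiplication-8305, line `spherical-rank-sieve`; c2 brick).  For permutations `μ₀, μ₁, μ₂`
of `Fin n`, sets `X_i` of permutations commuting with `μ_i` and having the triple product property,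
and a finite set `T` of triples of permutations containing `1`, closed under componentwise product and
inverse, all of whose elements `(a, b, c)` are hosted (`a μ₀ = μ₀ a`, `b μ₁ = μ₁ b`, `c μ₂ = μ₂ c`) and
satisfy the RELATIVE product-one condition
`a ∈ Q(X₀) ∧ b ∈ Q(X₁) ∧ c ∈ Q(X₂) → abc = 1` (`Q(X) = {x' x⁻¹ : x, x' ∈ X}`):
`|X₀||X₁||X₂| · |T| ≤ |C(μ₀)||C(μ₁)||C(μ₂)|` with `C(μ) = univ.filter (σ μ = μ σ)`.
Strictly generalises the landed `stub_groupPacking` (where `abc = 1` is demanded of every element of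
`T`). [folklore] -/
theorem stub_relativePacking : ∀ (n : ℕ) (μ : Fin 3 → Equiv.Perm (Fin n)) (X : Fin 3 → Finset (Equiv.Perm (Fin n))) (T : Finset (Equiv.Perm (Fin n) × Equiv.Perm (Fin n) × Equiv.Perm (Fin n))), (∀ i, ∀ σ ∈ X i, σ * μ i = μ i * σ) → Literature.Combinatorics.Additive.TripleProductProperty (X 0) (X 1) (X 2) → (1 : Equiv.Perm (Fin n) × Equiv.Perm (Fin n) × Equiv.Perm (Fin n)) ∈ T → (∀ s ∈ T, ∀ t ∈ T, s * t ∈ T) → (∀ t ∈ T, t⁻¹ ∈ T) → (∀ t ∈ T, t.1 * μ 0 = μ 0 * t.1 ∧ t.2.1 * μ 1 = μ 1 * t.2.1 ∧ t.2.2 * μ 2 = μ 2 * t.2.2) → (∀ t ∈ T, (∃ x ∈ X 0, ∃ x' ∈ X 0, x' * x⁻¹ = t.1) → (∃ y ∈ X 1, ∃ y' ∈ X 1, y' * y⁻¹ = t.2.1) → (∃ z ∈ X 2, ∃ z' ∈ X 2, z' * z⁻¹ = t.2.2) → t.1 * t.2.1 * t.2.2 = 1) → (X 0).card * (X 1).card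 * (X 2).card * T.card ≤ (Finset.univ.filter (fun σ : Equiv.Perm (Fin n) => σ * μ 0 = μ 0 * σ)).card * (Finset.univ.filter (fun σ : Equiv.Perm (Fin n) => σ * μ 1 = μ 1 * σ)).card * (Finset.univ.filter (fun σ : Equiv.Perm (Fin n) => σ * μ 2 = μ 2 * σ)).card := by
  intro n μ X T hX hTPP h1 hmul hinv hhost hrel
  have hsub : ∀ i, X i ⊆ Finset.univ.filter (fun σ : Equiv.Perm (Fin n) => σ * μ i = μ i * σ) :=
    fun i σ hσ => Finset.mem_filter.2 ⟨Finset.mem_univ _, hX i σ hσ⟩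
  refine card_mul_card_le_of_tpp_of_relHosted (hsub 0) (hsub 1) (hsub 2)
    (inv_mul_mem_filter_comm (μ 0)) (inv_mul_mem_filter_comm (μ 1))
    (inv_mul_mem_filter_comm (μ 2)) hTPP hmul hinv ⟨1, h1⟩ (fun t ht => ?_) hrel
  obtain ⟨h₀, h₁, h₂⟩ := hhost t ht
  exact ⟨Finset.mem_filter.2 ⟨Finset.mem_univ _, h₀⟩, Finset.mem_filter.2 ⟨Finset.mem_univ _, h₁⟩,
    Finset.mem_filter.2 ⟨Finset.mem_univ _, h₂⟩⟩

/-- **Set-only (diagonal) instance** — cubic pairwise packing.  For `X_i ⊆ C(μ_i)` with the triple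
product property and ANY finite set `A` of permutations commuting with both `μ₀` and `μ₁`, containing
`1` and closed under product and inverse, `|X₀||X₁||X₂| · |A| ≤ |C(μ₀)||C(μ₁)||C(μ₂)|`.  Here
`T = {(a, a, 1) : a ∈ A}` is NOT product-one, but (REL) holds because `a ∈ Q(X₀) ∩ Q(X₁)` forces
`a = 1` by the triple product property (`x' x⁻¹ · (y y'⁻¹) · (z z⁻¹) = a a⁻¹ = 1`).  (Cohn–Umans
pairwise packing gives the sharper square-root form; the point of this corollary is only that the
relative lemma interpolates between the host-only and the set-only packings.) [folklore] -/
theorem diagonalPacking (n : ℕ) (μ : Fin 3 → Equiv.Perm (Fin n))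
    (X : Fin 3 → Finset (Equiv.Perm (Fin n))) (A : Finset (Equiv.Perm (Fin n)))
    (hX : ∀ i, ∀ σ ∈ X i, σ * μ i = μ i * σ)
    (hTPP : TripleProductProperty (X 0) (X 1) (X 2))
    (h1 : (1 : Equiv.Perm (Fin n)) ∈ A) (hmul : ∀ a ∈ A, ∀ b ∈ A, a * b ∈ A)
    (hinv : ∀ a ∈ A, a⁻¹ ∈ A)
    (hA : ∀ a ∈ A, a * μ 0 = μ 0 * a ∧ a * μ 1 = μ 1 * a) :
    (X 0).card * (X 1).card * (X 2).card * A.card ≤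
      (Finset.univ.filter (fun σ : Equiv.Perm (Fin n) => σ * μ 0 = μ 0 * σ)).card *
        (Finset.univ.filter (fun σ : Equiv.Perm (Fin n) => σ * μ 1 = μ 1 * σ)).card *
          (Finset.univ.filter (fun σ : Equiv.Perm (Fin n) => σ * μ 2 = μ 2 * σ)).card := by
  classical
  -- the diagonal copy of `A`
  set T : Finset (Equiv.Perm (Fin n) × Equiv.Perm (Fin n) × Equiv.Perm (Fin n)) :=
    A.image (fun a => (a, a, (1 : Equiv.Perm (Fin n)))) with hTdef
  have hinjf : Function.Injective (fun a : Equiv.Perm (Fin n) => (a, a, (1 : Equiv.Perm (Fin n)))) :=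
    fun a b h => congrArg Prod.fst h
  have hTcard : T.card = A.card := Finset.card_image_of_injective _ hinjf
  have hmemT : ∀ t ∈ T, ∃ a ∈ A, (a, a, (1 : Equiv.Perm (Fin n))) = t := fun t ht =>
    Finset.mem_image.1 ht
  rw [← hTcard]
  refine stub_relativePacking n μ X T hX hTPP ?_ ?_ ?_ ?_ ?_
  · exact Finset.mem_image.2 ⟨1, h1, rfl⟩
  · intro s hs t ht
    obtain ⟨a, ha, rfl⟩ := hmemT s hs
    obtain ⟨b, hb, rfl⟩ := hmemT t ht
    refine Finset.mem_image.2 ⟨a * b, hmul a ha b hb, ?_⟩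
    simp only [Prod.mk_mul_mk, mul_one]
  · intro t ht
    obtain ⟨a, ha, rfl⟩ := hmemT t ht
    refine Finset.mem_image.2 ⟨a⁻¹, hinv a ha, ?_⟩
    simp only [Prod.inv_mk, inv_one]
  · intro t ht
    obtain ⟨a, ha, rfl⟩ := hmemT t ht
    exact ⟨(hA a ha).1, (hA a ha).2, by simp⟩
  · intro t ht hx hy hz
    obtain ⟨a, ha, rfl⟩ := hmemT t ht
    obtain ⟨x, hx, x', hx', hxa⟩ := hx
    obtain ⟨y, hy, y', hy', hya⟩ := hy
    obtain ⟨z, hz, -, -, -⟩ := hz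
    simp only at hxa hya
    -- `a ∈ Q(X₀) ∩ Q(X₁)` ⇒ `a = 1` by the TPP applied to `x' x⁻¹ · (y y'⁻¹) · (z z⁻¹) = a a⁻¹`
    have hya' : y * y'⁻¹ = a⁻¹ := by rw [← hya, mul_inv_rev, inv_inv]
    have key : x' * x⁻¹ * (y * y'⁻¹) * (z * z⁻¹) = 1 := by
      rw [hxa, hya', mul_inv_cancel, one_mul, mul_inv_cancel]
    obtain ⟨rfl, -, -⟩ := hTPP x' hx' x hx y hy y' hy' z hz z hz key
    rw [mul_inv_cancel] at hxa
    simp only [← hxa, mul_one]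

end Summit.MatrixMultiplication.MatrixMultiplication.Theorems.HyperoctahedralSubsets
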